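import Summits.BirchSwinnertonDyer.BirchSwinnertonDyer.Theorems.PrintCFramBottomClassIndexLawFiveLeHerbrandEigenspaceDecomposition
import HarnessLib

/-!
# Route `PrintCFram`, crux C2 `BottomClassIndexLawFiveLe` (stmt-BirchSwinnertonDyer-20372), line
# `eisenstein-resource-bdp-line` v10, Stub H `stub_bottomResidualSelmer_trivial_of_bernoulliPair`, typing item T3 of
# `Lines/herbrand-regular-locus-M1-anatomy.md` §8, part 4: DÉVISSAGE OF `χ`-PARTS (sub/quotient representations, exact
# pairs) AND `χ`-PARTS UNDER AN EQUIVARIANT PAIRING (the algebra of Leopoldt reflection F2 / Kummer and Tate pairings)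
# (cell `bsd-print-cfram`, seat `bsd-line-cfram-p1-w4` g4; helper `--supports` 20372; 0 facts, 0 defs)

HONEST FRAMING. Nothing about BSD is proved here. Pure algebra continuing `…HerbrandEigenspaceProjectors` /
`…Decomposition` (the `χ`-part `V^{(χ)} = ⨅ g, eigenspace (ρ g) (χ g)`, projector `e_χ`, both written out). Two tools
the bound (M1) of the herbrand anatomy uses without saying so:
* **Dévissage.** For a `G`-stable submodule `W ≤ V` (Mathlib `ρ.subrepresentation W hW`, `ρ.quotient W hW`):
  `mem_iInf_eigenspace_subrepresentation_iff` (`W^{(χ)} = W ∩ V^{(χ)}`), `map_mkQ_iInf_eigenspace_eq`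
  (`(V/W)^{(χ)} = image of V^{(χ)}`, `|G| ∈ kˣ`), **`iInf_eigenspace_eq_bot_of_sub_of_quotient`**
  (`W ∩ V^{(χ)} = 0 ∧ (V/W)^{(χ)} = 0 ⟹ V^{(χ)} = 0`) and the abstract exact-pair form
  **`iInf_eigenspace_eq_bot_of_exact`** (`U → V → W` exact, `U^{(χ)} = 0 = W^{(χ)} ⟹ V^{(χ)} = 0`) — this is how
  `dim R ≤ dim(unit term)^{(θ)} + dim(class group term)^{(θ)}` and "all six terms vanish ⟹ R = 0" are consumed;
  `iInf_eigenspace_eq_bot_of_injective`.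
* **Equivariant pairings.** For `B : X × Y → T` bilinear with `B(g x, g y) = ω(g) • B(x, y)` (Kummer pairing into
  `μ_p = 𝔽_p(ω)`, Weil/Tate pairings into `ℚ_p/ℤ_p(1)`): `pairing_eq_zero_of_mem_of_mem_of_isUnit` /
  `pairing_eq_zero_of_mem_of_mem` — **`X^{(χ)} ⟂ Y^{(ψ)}` unless `χψ = ω`** (unit version for any `T`; domain version
  for torsion-free `T`), and, for `G` abelian with enough roots of unity and `B` left-non-degenerate,
  **`eq_zero_of_mem_of_forall_pairing_eq_zero`**: an `x ∈ X^{(χ)}` orthogonal to `Y^{(χ⁻¹ω)}` is `0` — i.e.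
  `X^{(χ)} ↪ Hom(Y^{(χ⁻¹ω)}, T)`, the REFLECTION inequality pattern `dim A^{(χ)} ≤ dim (radical)^{(ωχ⁻¹)}` of
  Washington Thm. 10.9 / anatomy F2 once the Kummer pairing is supplied.

THEOREMS ONLY; no definition, no named fact, no `sorry`; imports no `Theses` module. BSD is not proved by any of
this; no summit statement is proved by this seat.
References: [Washington1997] §6.3, §10.2 (Thm. 10.9, Leopoldt's Spiegelungssatz); [Lang1990] Ch. 1 §3;
[Gross1980] Lemma 22.3.4 (reflection step).
-/

set_option autoImplicit false
-- `…BirchSwinnertonDyer.BirchSwinnertonDyer.Theorems…` is the problem's mandated namespace (D-0017).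
set_option linter.dupNamespace false

namespace Summit.BirchSwinnertonDyer.BirchSwinnertonDyer.Theorems.PrintCFram.HerbrandEigenspace

open Module Module.End Representation

/-! ## Sub- and quotient representations -/

section SubQuotient

variable {k G V : Type*} [CommRing k] [Group G] [AddCommGroup V] [Module k V]
  (ρ : Representation k G V) (χ : G →* kˣ) (W : Submodule k V) (hW : ∀ g : G, W ≤ W.comap (ρ g))

/-- The inclusion of a stable submodule is equivariant. [folklore] -/
theorem subtype_comp_subrepresentation (g : G) :
    W.subtype ∘ₗ (ρ.subrepresentation W hW) g = ρ g ∘ₗ W.subtype := by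
  refine LinearMap.ext fun w => ?_
  simp only [LinearMap.comp_apply, subrepresentation_apply, Submodule.subtype_apply, LinearMap.coe_restrict_apply]

/-- The quotient map by a stable submodule is equivariant. [folklore] -/
theorem mkQ_comp_eq_quotient_comp_mkQ (g : G) :
    W.mkQ ∘ₗ ρ g = (ρ.quotient W hW) g ∘ₗ W.mkQ := by
  refine LinearMap.ext fun v => ?_
  simp only [LinearMap.comp_apply, Submodule.mkQ_apply, quotient_apply, Submodule.mapQ_apply]

/-- **`W^{(χ)} = W ∩ V^{(χ)}`**: `w ∈ W` lies in the `χ`-part of the subrepresentation iff it lies in `V^{(χ)}`. [folklore] -/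
theorem mem_iInf_eigenspace_subrepresentation_iff (w : W) :
    w ∈ ⨅ g : G, eigenspace ((ρ.subrepresentation W hW) g) (χ g : k) ↔ (w : V) ∈ ⨅ g : G, eigenspace (ρ g) (χ g : k) :=
  mem_iInf_eigenspace_iff_of_injective (ρ.subrepresentation W hW) ρ χ W.subtype
    (subtype_comp_subrepresentation ρ W hW) W.subtype_injective w

/-- The `χ`-part of a stable submodule vanishes iff `W ∩ V^{(χ)} = 0`. [folklore] -/
theorem iInf_eigenspace_subrepresentation_eq_bot_iff :
    (⨅ g : G, eigenspace ((ρ.subrepresentation W hW) g) (χ g : k)) = ⊥ ↔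
      W ⊓ (⨅ g : G, eigenspace (ρ g) (χ g : k)) = ⊥ := by
  simp only [Submodule.eq_bot_iff, Submodule.mem_inf]
  constructor
  · intro h v hv
    have := h ⟨v, hv.1⟩ ((mem_iInf_eigenspace_subrepresentation_iff ρ χ W hW ⟨v, hv.1⟩).mpr hv.2)
    exact congrArg Subtype.val this
  · intro h w hw
    exact Subtype.ext (h w ⟨w.2, (mem_iInf_eigenspace_subrepresentation_iff ρ χ W hW w).mp hw⟩)

/-- An equivariant INJECTION reflects vanishing: `V^{(χ)} = 0 ⟹ U^{(χ)} = 0`. [folklore] -/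
theorem iInf_eigenspace_eq_bot_of_injective {U : Type*} [AddCommGroup U] [Module k U] (τ : Representation k G U)
    (f : U →ₗ[k] V) (hf : ∀ g : G, f ∘ₗ τ g = ρ g ∘ₗ f) (hinj : Function.Injective f)
    (hV : (⨅ g : G, eigenspace (ρ g) (χ g : k)) = ⊥) : (⨅ g : G, eigenspace (τ g) (χ g : k)) = ⊥ := by
  refine (Submodule.eq_bot_iff _).mpr fun u hu => hinj ?_
  have hfu := (mem_iInf_eigenspace_iff_of_injective τ ρ χ f hf hinj u).mp hu
  rw [hV] at hfu
  rw [(Submodule.mem_bot k).mp hfu, map_zero]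

variable [Fintype G] [Invertible (Fintype.card G : k)]

/-- **`(V/W)^{(χ)}` is the image of `V^{(χ)}`** (`|G| ∈ kˣ`). [cite: Washington1997, §6.3] [folklore] -/
theorem map_mkQ_iInf_eigenspace_eq :
    (⨅ g : G, eigenspace (ρ g) (χ g : k)).map W.mkQ = ⨅ g : G, eigenspace ((ρ.quotient W hW) g) (χ g : k) :=
  map_iInf_eigenspace_eq_of_surjective ρ (ρ.quotient W hW) χ W.mkQ (mkQ_comp_eq_quotient_comp_mkQ ρ W hW)
    (Submodule.mkQ_surjective W)

/-- **Exact-pair vanishing**: for equivariant `f : U → V`, `f' : V → W'` with `range f = ker f'`, if `U^{(χ)} = 0` and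
`W'^{(χ)} = 0` then `V^{(χ)} = 0` (`|G| ∈ kˣ`). [cite: Washington1997, §6.3] [folklore] -/
theorem iInf_eigenspace_eq_bot_of_exact {U W' : Type*} [AddCommGroup U] [Module k U] [AddCommGroup W'] [Module k W']
    (τ : Representation k G U) (σ : Representation k G W') (f : U →ₗ[k] V) (f' : V →ₗ[k] W')
    (hf : ∀ g : G, f ∘ₗ τ g = ρ g ∘ₗ f) (hf' : ∀ g : G, f' ∘ₗ ρ g = σ g ∘ₗ f')
    (hex : LinearMap.range f = LinearMap.ker f') (hU : (⨅ g : G, eigenspace (τ g) (χ g : k)) = ⊥)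
    (hW' : (⨅ g : G, eigenspace (σ g) (χ g : k)) = ⊥) : (⨅ g : G, eigenspace (ρ g) (χ g : k)) = ⊥ := by
  refine (Submodule.eq_bot_iff _).mpr fun v hv => ?_
  have hker : v ∈ LinearMap.ker f' := by
    have := map_iInf_eigenspace_le ρ σ χ f' hf' (Submodule.mem_map_of_mem hv)
    rw [hW'] at this
    exact LinearMap.mem_ker.mpr ((Submodule.mem_bot k).mp this)
  have hmem : v ∈ (⨅ g : G, eigenspace (τ g) (χ g : k)).map f := by
    rw [map_iInf_eigenspace_eq_inf_ker τ ρ χ f f' hf hex]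
    exact Submodule.mem_inf.mpr ⟨hv, hker⟩
  rw [hU, Submodule.map_bot] at hmem
  exact (Submodule.mem_bot k).mp hmem

/-- **Dévissage**: `W ∩ V^{(χ)} = 0` and `(V/W)^{(χ)} = 0` imply `V^{(χ)} = 0` (`|G| ∈ kˣ`).
[cite: Washington1997, §6.3] [folklore] -/
theorem iInf_eigenspace_eq_bot_of_sub_of_quotient (hsub : W ⊓ (⨅ g : G, eigenspace (ρ g) (χ g : k)) = ⊥)
    (hquot : (⨅ g : G, eigenspace ((ρ.quotient W hW) g) (χ g : k)) = ⊥) :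
    (⨅ g : G, eigenspace (ρ g) (χ g : k)) = ⊥ :=
  iInf_eigenspace_eq_bot_of_exact ρ χ (ρ.subrepresentation W hW) (ρ.quotient W hW) W.subtype W.mkQ
    (subtype_comp_subrepresentation ρ W hW) (mkQ_comp_eq_quotient_comp_mkQ ρ W hW)
    (by rw [Submodule.range_subtype, Submodule.ker_mkQ])
    ((iInf_eigenspace_subrepresentation_eq_bot_iff ρ χ W hW).mpr hsub) hquot

/-- Conversely `V^{(χ)} = 0` forces `W ∩ V^{(χ)} = 0` and `(V/W)^{(χ)} = 0`. [folklore] -/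
theorem sub_and_quotient_eq_bot_of_iInf_eigenspace_eq_bot (hV : (⨅ g : G, eigenspace (ρ g) (χ g : k)) = ⊥) :
    W ⊓ (⨅ g : G, eigenspace (ρ g) (χ g : k)) = ⊥ ∧
      (⨅ g : G, eigenspace ((ρ.quotient W hW) g) (χ g : k)) = ⊥ := by
  refine ⟨by rw [hV, inf_bot_eq], ?_⟩
  rw [← map_mkQ_iInf_eigenspace_eq ρ χ W hW, hV, Submodule.map_bot]

end SubQuotient

/-! ## `χ`-parts under an `ω`-equivariant pairing -/

section Pairing

variable {k G X Y T : Type*} [CommRing k] [Group G] [AddCommGroup X] [Module k X] [AddCommGroup Y] [Module k Y]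
  [AddCommGroup T] [Module k T] (ρX : Representation k G X) (ρY : Representation k G Y)
  (B : X →ₗ[k] Y →ₗ[k] T) (ω χ ψ : G →* kˣ)
  (hB : ∀ (g : G) (x : X) (y : Y), B (ρX g x) (ρY g y) = (ω g : k) • B x y)

include hB in
/-- The basic relation: for `x ∈ X^{(χ)}`, `y ∈ Y^{(ψ)}` and every `g`, `(χ(g)ψ(g) − ω(g)) • B(x, y) = 0`. [folklore] -/
theorem sub_smul_pairing_eq_zero {x : X} {y : Y} (hx : x ∈ ⨅ g : G, eigenspace (ρX g) (χ g : k))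
    (hy : y ∈ ⨅ g : G, eigenspace (ρY g) (ψ g : k)) (g : G) :
    ((χ g : k) * (ψ g : k) - (ω g : k)) • B x y = 0 := by
  rw [mem_iInf_eigenspace_iff] at hx hy
  have e := hB g x y
  rw [hx g, hy g, map_smul, map_smul, LinearMap.smul_apply, smul_smul, mul_comm (ψ g : k)] at e
  rw [sub_smul, e, sub_self]

include hB in
/-- **`X^{(χ)} ⟂ Y^{(ψ)}` unless `χψ = ω`, unit version** (any target `T`, e.g. `ℚ_p/ℤ_p(1)`): if `χ(g₀)ψ(g₀) − ω(g₀)` is a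
unit for one `g₀` then `B(x, y) = 0`. [cite: Washington1997, §10.2] [folklore] -/
theorem pairing_eq_zero_of_mem_of_mem_of_isUnit {x : X} {y : Y} (hx : x ∈ ⨅ g : G, eigenspace (ρX g) (χ g : k))
    (hy : y ∈ ⨅ g : G, eigenspace (ρY g) (ψ g : k)) (g₀ : G)
    (hu : IsUnit ((χ g₀ : k) * (ψ g₀ : k) - (ω g₀ : k))) : B x y = 0 := by
  have h0 := sub_smul_pairing_eq_zero ρX ρY B ω χ ψ hB hx hy g₀
  obtain ⟨u, hu⟩ := hu
  rw [← hu] at h0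
  simpa using congrArg (fun t => ((u⁻¹ : kˣ) : k) • t) h0

include hB in
/-- **`X^{(χ)} ⟂ Y^{(ψ)}` unless `χψ = ω`, domain version** (`k` a domain, `T` torsion-free, e.g. `T = k = 𝔽_p` for the
Kummer pairing into `μ_p`). [cite: Washington1997, §10.2] [folklore] -/
theorem pairing_eq_zero_of_mem_of_mem [IsDomain k] [NoZeroSMulDivisors k T] (hne : χ * ψ ≠ ω) {x : X} {y : Y}
    (hx : x ∈ ⨅ g : G, eigenspace (ρX g) (χ g : k)) (hy : y ∈ ⨅ g : G, eigenspace (ρY g) (ψ g : k)) :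
    B x y = 0 := by
  obtain ⟨g₀, hg₀⟩ : ∃ g₀ : G, (χ * ψ) g₀ ≠ ω g₀ := not_forall.mp fun h => hne (MonoidHom.ext h)
  have h0 := sub_smul_pairing_eq_zero ρX ρY B ω χ ψ hB hx hy g₀
  rcases smul_eq_zero.mp h0 with h | h
  · refine absurd (Units.val_injective ?_) hg₀
    rw [MonoidHom.mul_apply, Units.val_mul]
    exact sub_eq_zero.mp h
  · exact h

end Pairing

section PairingAbelian

variable {k G X Y T : Type*} [CommRing k] [CommGroup G] [AddCommGroup X] [Module k X] [AddCommGroup Y] [Module k Y]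
  [AddCommGroup T] [Module k T] (ρX : Representation k G X) (ρY : Representation k G Y)
  (B : X →ₗ[k] Y →ₗ[k] T) (ω χ : G →* kˣ)
  (hB : ∀ (g : G) (x : X) (y : Y), B (ρX g x) (ρY g y) = (ω g : k) • B x y)

include hB in
/-- **Reflection / duality pattern**: for `G` abelian of order invertible in a domain `k` with enough roots of unity and
a LEFT-NON-DEGENERATE `ω`-equivariant pairing into a torsion-free `T`, an element of `X^{(χ)}` orthogonal to the single
partner part `Y^{(χ⁻¹ω)}` is zero: `X^{(χ)} ↪ Hom(Y^{(χ⁻¹ω)}, T)`. (`Y = ⊕_ψ Y^{(ψ)}` and `X^{(χ)} ⟂ Y^{(ψ)}` for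
`ψ ≠ χ⁻¹ω`.) [cite: Washington1997, §10.2 (Thm. 10.9)] [folklore] -/
theorem eq_zero_of_mem_of_forall_pairing_eq_zero [Fintype G] [IsDomain k] [NoZeroSMulDivisors k T]
    [HasEnoughRootsOfUnity k (Monoid.exponent G)] [Invertible (Fintype.card G : k)]
    (hnd : ∀ x : X, (∀ y : Y, B x y = 0) → x = 0) {x : X} (hx : x ∈ ⨅ g : G, eigenspace (ρX g) (χ g : k))
    (horth : ∀ y ∈ ⨅ g : G, eigenspace (ρY g) ((χ⁻¹ * ω) g : k), B x y = 0) : x = 0 := by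
  haveI : Fintype (G →* kˣ) := @Fintype.ofFinite _ finite_monoidHom_units
  refine hnd x fun y => ?_
  rw [← sum_proj_apply ρY y, map_sum]
  refine Finset.sum_eq_zero fun ψ' _ => ?_
  by_cases hψ : ψ' = χ⁻¹ * ω
  · subst hψ
    exact horth _ (proj_mem ρY _ y)
  · refine pairing_eq_zero_of_mem_of_mem ρX ρY B ω χ ψ' hB ?_ hx (proj_mem ρY ψ' y)
    intro h
    apply hψ
    rw [← h]
    exact MonoidHom.ext fun g => by simp

include hB in
/-- Unit version of the reflection pattern (any target `T`): if for every `ψ ≠ χ⁻¹ω` some `χ(g)ψ(g) − ω(g)` is a unit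
(Teichmüller-valued characters), an `x ∈ X^{(χ)}` orthogonal to `Y^{(χ⁻¹ω)}` is zero. [cite: Washington1997, §10.2] [folklore] -/
theorem eq_zero_of_mem_of_forall_pairing_eq_zero_of_isUnit [Fintype G] [IsDomain k]
    [HasEnoughRootsOfUnity k (Monoid.exponent G)] [Invertible (Fintype.card G : k)]
    (hunit : ∀ ψ' : G →* kˣ, ψ' ≠ χ⁻¹ * ω → ∃ g : G, IsUnit ((χ g : k) * (ψ' g : k) - (ω g : k)))
    (hnd : ∀ x : X, (∀ y : Y, B x y = 0) → x = 0) {x : X} (hx : x ∈ ⨅ g : G, eigenspace (ρX g) (χ g : k))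
    (horth : ∀ y ∈ ⨅ g : G, eigenspace (ρY g) ((χ⁻¹ * ω) g : k), B x y = 0) : x = 0 := by
  haveI : Fintype (G →* kˣ) := @Fintype.ofFinite _ finite_monoidHom_units
  refine hnd x fun y => ?_
  rw [← sum_proj_apply ρY y, map_sum]
  refine Finset.sum_eq_zero fun ψ' _ => ?_
  by_cases hψ : ψ' = χ⁻¹ * ω
  · subst hψ
    exact horth _ (proj_mem ρY _ y)
  · obtain ⟨g₀, hg₀⟩ := hunit ψ' hψ
    exact pairing_eq_zero_of_mem_of_mem_of_isUnit ρX ρY B ω χ ψ' hB hx (proj_mem ρY ψ' y) g₀ hg₀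

end PairingAbelian

end Summit.BirchSwinnertonDyer.BirchSwinnertonDyer.Theorems.PrintCFram.HerbrandEigenspace
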